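import Mathlib

/-!
# Tier 3 / T3.1 — PERIOD.md §4.1 on the kernel: a character occurs in the closed span of a
translation-stable family of continuous functions on a compact group iff one of its periods
against that character is non-zero

T3.5 twin (seat t3-p1) of the CELL sentence of `proofs/t3-p1/PERIOD.md` §4.1:

> «Since `E(g′h, ½; f) = E(g′, ½; ω(h)f)` for `h ∈ (T×T′)(𝔸_f)` and the character is trivial on
> `(T×T′)(E′⁺)`, the family `{E(·,½,f)|_{[T×T′]} : f}` is translation-stable, and `𝒫 ≠ 0` for some `f`
> iff the character `χ₀⊗χ₁⊗χ̄₂⊗χ̄₃` of the compact abelian group `[T×T′]` OCCURS in the closed span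
> of the restrictions — the cleanest statement of the residual.»

Setting: `G` a compact topological group, `μ` a Haar probability measure on it (left-invariant
for the translation lemma, right-invariant for the projection lemma — on the abelian group
`[T × T′]` of the application every left-invariant measure is right-invariant, Mathlib's
`IsMulLeftInvariant.isMulRightInvariant`), `χ : C(G, ℂ)` a continuous unitary character
(`χ (s * t) = χ s * χ t`, `‖χ t‖ = 1`), and for `v : C(G, ℂ)` the *period*
`∫ t, conj (χ t) * v t ∂μ` (the `χ`-Fourier coefficient of `v`). The translates of `v` are any
family `T : G → C(G, ℂ)` with `T t x = v (t * x)`.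

* `integral_conj_mul_mul_left` — the period of a translate: `𝒫(T s v) = χ s · 𝒫(v)`;
* `integral_conj_mul_mul_right` — the isotypic projection evaluated at a point:
  `∫ t, conj (χ t) * v (t * x) ∂μ = χ x · 𝒫(v)`;
* `integral_smul_mem_topologicalClosure_span` — a Bochner integral `∫ c t • f t` lies in the
  closed span of the values `f t` (for continuous `c`, `f` on the compact group);
* `mem_topologicalClosure_span_of_integral_ne_zero` — `𝒫(v) ≠ 0 ⇒ χ` lies in the closed span
  of the translates of `v` (the isotypic projection `∫ t, conj (χ t) • T t ∂μ` equals
  `𝒫(v) • χ` and lies in that closed span);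
* `integral_ne_zero_of_mem_topologicalClosure_span` — the converse: the period functional is a
  continuous linear functional killing every translate when `𝒫(v) = 0`, hence the closed span,
  but `𝒫(χ) = 1`;
* `integral_ne_zero_iff_mem_topologicalClosure_span` — the equivalence for one `v`;
* `exists_integral_ne_zero_iff_mem_topologicalClosure_span` — the §4.1 statement for a
  translation-stable family `F : ι → C(G, ℂ)`: `(∃ i, 𝒫(F i) ≠ 0) ↔ χ ∈ closure (span (range F))`.

Nothing here is specific to the Eisenstein series: the only inputs are the invariance of the
Haar measure, the Bochner integral commuting with continuous linear maps, and the completeness of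
`C(G, ℂ)`. Theorems only, no definition; `import Mathlib` only.
HC_CM is NOT proved by anyone in this repository.
-/

open MeasureTheory ComplexConjugate

namespace HodgeRepro.T3P1.IsotypicProjection

section Unitary

variable {G : Type*}

/-- For a unitary character, `χ s * conj (χ s) = 1`. -/
theorem mul_conj_eq_one {χ : G → ℂ} (hn : ∀ t, ‖χ t‖ = 1) (s : G) : χ s * conj (χ s) = 1 := by
  rw [Complex.mul_conj', hn s]
  norm_num

/-- For a unitary character, `conj (χ s) * χ s = 1`. -/
theorem conj_mul_eq_one {χ : G → ℂ} (hn : ∀ t, ‖χ t‖ = 1) (s : G) : conj (χ s) * χ s = 1 := by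
  rw [Complex.conj_mul', hn s]
  norm_num

end Unitary

section Characters

variable {G : Type*} [Group G]

/-- A multiplicative map of norm one takes the value `1` at the identity. -/
theorem map_one_of_mul {χ : G → ℂ} (hχ : ∀ s t, χ (s * t) = χ s * χ t) (hn : ∀ t, ‖χ t‖ = 1) :
    χ 1 = 1 := by
  have h0 : χ 1 ≠ 0 := by
    intro h0
    have := hn 1
    rw [h0, norm_zero] at this
    exact zero_ne_one this
  have h : χ 1 * χ 1 = χ 1 * 1 := by rw [← hχ 1 1, one_mul, mul_one]
  exact mul_left_cancel₀ h0 h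

/-- For a unitary character, `χ s⁻¹ = conj (χ s)`. -/
theorem map_inv_eq_conj {χ : G → ℂ} (hχ : ∀ s t, χ (s * t) = χ s * χ t) (hn : ∀ t, ‖χ t‖ = 1)
    (s : G) : χ s⁻¹ = conj (χ s) := by
  have hne : χ s ≠ 0 := by
    intro h0
    have := hn s
    rw [h0, norm_zero] at this
    exact zero_ne_one this
  have h1 : χ s⁻¹ * χ s = 1 := by rw [← hχ, inv_mul_cancel, map_one_of_mul hχ hn]
  exact mul_right_cancel₀ hne (h1.trans (conj_mul_eq_one hn s).symm)

end Characters

section Invariance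

variable {G : Type*} [Group G] [TopologicalSpace G] [IsTopologicalGroup G] [MeasurableSpace G]
  [BorelSpace G] (μ : Measure G)

/-- The period of a left translate: `∫ conj (χ t) * v (s * t) = χ s * ∫ conj (χ t) * v t`
(left-invariance of the measure). -/
theorem integral_conj_mul_mul_left [μ.IsMulLeftInvariant] {χ : G → ℂ}
    (hχ : ∀ s t, χ (s * t) = χ s * χ t) (hn : ∀ t, ‖χ t‖ = 1) (v : G → ℂ) (s : G) :
    ∫ t, conj (χ t) * v (s * t) ∂μ = χ s * ∫ t, conj (χ t) * v t ∂μ := by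
  have key : (fun t => conj (χ t) * v (s * t)) =
      fun t => (fun u => χ s * (conj (χ u) * v u)) (s * t) := by
    funext t
    show conj (χ t) * v (s * t) = χ s * (conj (χ (s * t)) * v (s * t))
    rw [hχ s t, map_mul]
    calc conj (χ t) * v (s * t) = (χ s * conj (χ s)) * (conj (χ t) * v (s * t)) := by
          rw [mul_conj_eq_one hn s, one_mul]
      _ = χ s * (conj (χ s) * conj (χ t) * v (s * t)) := by ring
  rw [key, integral_mul_left_eq_self (fun u => χ s * (conj (χ u) * v u)) s, integral_const_mul]

/-- The isotypic projection evaluated at a point: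
`∫ conj (χ t) * v (t * x) = χ x * ∫ conj (χ t) * v t` (right-invariance of the measure). -/
theorem integral_conj_mul_mul_right [μ.IsMulRightInvariant] {χ : G → ℂ}
    (hχ : ∀ s t, χ (s * t) = χ s * χ t) (hn : ∀ t, ‖χ t‖ = 1) (v : G → ℂ) (x : G) :
    ∫ t, conj (χ t) * v (t * x) ∂μ = χ x * ∫ t, conj (χ t) * v t ∂μ := by
  have key : (fun t => conj (χ t) * v (t * x)) =
      fun t => (fun u => χ x * (conj (χ u) * v u)) (t * x) := by
    funext t
    show conj (χ t) * v (t * x) = χ x * (conj (χ (t * x)) * v (t * x))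
    rw [hχ t x, map_mul]
    calc conj (χ t) * v (t * x) = (χ x * conj (χ x)) * (conj (χ t) * v (t * x)) := by
          rw [mul_conj_eq_one hn x, one_mul]
      _ = χ x * (conj (χ t) * conj (χ x) * v (t * x)) := by ring
  rw [key, integral_mul_right_eq_self (fun u => χ x * (conj (χ u) * v u)) x, integral_const_mul]

end Invariance

section Probability

variable {G : Type*} [MeasurableSpace G] (μ : Measure G) [IsProbabilityMeasure μ]

/-- The period of the character against itself is `1` (probability measure). -/
theorem integral_conj_mul_self {χ : G → ℂ} (hn : ∀ t, ‖χ t‖ = 1) :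
    ∫ t, conj (χ t) * χ t ∂μ = 1 := by
  have h : ∀ t, conj (χ t) * χ t = (1 : ℂ) := fun t => conj_mul_eq_one hn t
  simp_rw [h]
  rw [integral_const, probReal_univ, one_smul]

end Probability

section Translates

variable {G : Type*} [Group G] [TopologicalSpace G] [IsTopologicalGroup G]

/-- A family of translates `T t x = v (t * x)` of a continuous function on a topological group is
a continuous map `G → C(G, ℂ)` (compact-open topology; on a compact group this is the sup-norm
topology). -/
theorem continuous_translate (v : C(G, ℂ)) (T : G → C(G, ℂ)) (hT : ∀ t x, T t x = v (t * x)) :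
    Continuous T := by
  apply ContinuousMap.continuous_of_continuous_uncurry
  have : (Function.uncurry fun t x => T t x) = fun p : G × G => v (p.1 * p.2) := by
    funext p
    exact hT p.1 p.2
  rw [this]
  exact v.continuous.comp continuous_mul

end Translates

section Compact

variable {G : Type*} [TopologicalSpace G] [CompactSpace G] [MeasurableSpace G] [BorelSpace G]
  (μ : Measure G) [IsProbabilityMeasure μ]

/-- A continuous function on a compact space is integrable for every finite Borel measure. -/
theorem integrable_of_continuous {E : Type*} [NormedAddCommGroup E] {f : G → E}
    (hf : Continuous f) : Integrable f μ :=
  hf.integrable_of_hasCompactSupport (HasCompactSupport.of_compactSpace f)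

/-- A Bochner integral `∫ c t • f t ∂μ` of a continuous integrand lies in the closed span of the
values `f t` (the integrand takes values in that closed submodule, which is complete, and the
inclusion commutes with the integral). -/
theorem integral_smul_mem_topologicalClosure_span {E : Type*} [NormedAddCommGroup E]
    [NormedSpace ℂ E] [CompleteSpace E] {f : G → E} (hf : Continuous f) {c : G → ℂ}
    (hc : Continuous c) :
    ∫ t, c t • f t ∂μ ∈ (Submodule.span ℂ (Set.range f)).topologicalClosure := by
  set S := (Submodule.span ℂ (Set.range f)).topologicalClosure with hS
  have : CompleteSpace S := (Submodule.isClosed_topologicalClosure _).completeSpace_coe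
  have hmem : ∀ t, c t • f t ∈ S := fun t =>
    S.smul_mem _ (Submodule.le_topologicalClosure _ (Submodule.subset_span ⟨t, rfl⟩))
  let g : G → S := fun t => ⟨c t • f t, hmem t⟩
  have hg : Continuous g := (hc.smul hf).subtype_mk _
  have hgi : Integrable g μ := integrable_of_continuous μ hg
  have h : ∫ t, c t • f t ∂μ = S.subtypeL (∫ t, g t ∂μ) := by
    rw [← ContinuousLinearMap.integral_comp_comm S.subtypeL hgi]
    rfl
  rw [h]
  exact (∫ t, g t ∂μ).2

/-- The period functional `w ↦ ∫ conj (χ t) * w t ∂μ` is a continuous linear functional on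
`C(G, ℂ)` (of norm `≤ 1` for a unitary `χ` and a probability measure). -/
theorem exists_period_clm {χ : G → ℂ} (hχc : Continuous χ) (hn : ∀ t, ‖χ t‖ = 1) :
    ∃ Λ : C(G, ℂ) →L[ℂ] ℂ, ∀ w : C(G, ℂ), Λ w = ∫ t, conj (χ t) * w t ∂μ := by
  have hint : ∀ w : C(G, ℂ), Integrable (fun t => conj (χ t) * w t) μ := fun w =>
    integrable_of_continuous μ ((Complex.continuous_conj.comp hχc).mul w.continuous)
  let L : C(G, ℂ) →ₗ[ℂ] ℂ :=
    { toFun := fun w => ∫ t, conj (χ t) * w t ∂μ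
      map_add' := fun w₁ w₂ => by
        simp only [ContinuousMap.add_apply, mul_add]
        exact integral_add (hint w₁) (hint w₂)
      map_smul' := fun a w => by
        simp only [ContinuousMap.smul_apply, smul_eq_mul, RingHom.id_apply]
        rw [← integral_const_mul]
        congr 1
        funext t
        ring }
  refine ⟨L.mkContinuous 1 ?_, fun w => rfl⟩
  intro w
  show ‖∫ t, conj (χ t) * w t ∂μ‖ ≤ 1 * ‖w‖
  rw [one_mul]
  calc ‖∫ t, conj (χ t) * w t ∂μ‖ ≤ ∫ _, ‖w‖ ∂μ := by
        apply norm_integral_le_of_norm_le (integrable_const _)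
        refine Filter.Eventually.of_forall fun t => ?_
        rw [norm_mul, RCLike.norm_conj, hn t, one_mul]
        exact ContinuousMap.norm_coe_le_norm w t
    _ = ‖w‖ := by rw [integral_const, probReal_univ, one_smul]

end Compact

section Main

variable {G : Type*} [Group G] [TopologicalSpace G] [IsTopologicalGroup G] [CompactSpace G]
  [MeasurableSpace G] [BorelSpace G] (μ : Measure G) [IsProbabilityMeasure μ]

/-- **Occurrence from a non-zero period.** If the period `∫ conj (χ t) * v t ∂μ` of a continuous
`v` against the continuous unitary character `χ` is non-zero, then `χ` lies in the closed span of
the translates `T t` of `v` (`T t x = v (t * x)`): the isotypic projection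
`∫ t, conj (χ t) • T t ∂μ` lies in that closed span and equals `(∫ conj (χ t) * v t ∂μ) • χ`. -/
theorem mem_topologicalClosure_span_of_integral_ne_zero [μ.IsMulRightInvariant] {χ : C(G, ℂ)}
    (hχ : ∀ s t, χ (s * t) = χ s * χ t) (hn : ∀ t, ‖χ t‖ = 1) (v : C(G, ℂ))
    (T : G → C(G, ℂ)) (hT : ∀ t x, T t x = v (t * x)) (hv : ∫ t, conj (χ t) * v t ∂μ ≠ 0) :
    χ ∈ (Submodule.span ℂ (Set.range T)).topologicalClosure := by
  have hTc : Continuous T := continuous_translate v T hT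
  have hcc : Continuous fun t => conj (χ t) := Complex.continuous_conj.comp χ.continuous
  have hP : ∫ t, conj (χ t) • T t ∂μ ∈ (Submodule.span ℂ (Set.range T)).topologicalClosure :=
    integral_smul_mem_topologicalClosure_span μ hTc hcc
  have hint : Integrable (fun t => conj (χ t) • T t) μ :=
    integrable_of_continuous μ (hcc.smul hTc)
  have hPχ : ∫ t, conj (χ t) • T t ∂μ = (∫ t, conj (χ t) * v t ∂μ) • χ := by
    ext x
    have h1 := ContinuousLinearMap.integral_comp_comm (ContinuousMap.evalCLM ℂ x) hint
    simp only [ContinuousMap.evalCLM_apply, ContinuousMap.smul_apply, smul_eq_mul] at h1 ⊢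
    rw [← h1]
    simp_rw [hT]
    rw [integral_conj_mul_mul_right μ hχ hn (fun y => v y) x]
    ring
  have hχeq : χ = (∫ t, conj (χ t) * v t ∂μ)⁻¹ • ∫ t, conj (χ t) • T t ∂μ := by
    rw [hPχ, smul_smul, inv_mul_cancel₀ hv, one_smul]
  rw [hχeq]
  exact Submodule.smul_mem _ _ hP

/-- **Non-zero period from occurrence.** If the continuous unitary character `χ` lies in the
closed span of the translates `T t` of `v` (`T t x = v (t * x)`), then the period
`∫ conj (χ t) * v t ∂μ` is non-zero: otherwise the period functional — a continuous linear
functional — vanishes on every translate (`integral_conj_mul_mul_left`), hence on the closed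
span, but its value at `χ` is `1`. -/
theorem integral_ne_zero_of_mem_topologicalClosure_span [μ.IsMulLeftInvariant] {χ : C(G, ℂ)}
    (hχ : ∀ s t, χ (s * t) = χ s * χ t) (hn : ∀ t, ‖χ t‖ = 1) (v : C(G, ℂ))
    (T : G → C(G, ℂ)) (hT : ∀ t x, T t x = v (t * x))
    (hmem : χ ∈ (Submodule.span ℂ (Set.range T)).topologicalClosure) :
    ∫ t, conj (χ t) * v t ∂μ ≠ 0 := by
  intro h0
  obtain ⟨Λ, hΛ⟩ := exists_period_clm μ χ.continuous hn
  have hker : (Submodule.span ℂ (Set.range T)).topologicalClosure ≤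
      LinearMap.ker (Λ : C(G, ℂ) →ₗ[ℂ] ℂ) := by
    apply Submodule.topologicalClosure_minimal
    · rw [Submodule.span_le]
      rintro _ ⟨t, rfl⟩
      simp only [SetLike.mem_coe, LinearMap.mem_ker, ContinuousLinearMap.coe_coe]
      rw [hΛ]
      simp_rw [hT]
      rw [integral_conj_mul_mul_left μ hχ hn (fun y => v y) t, h0, mul_zero]
    · exact Λ.isClosed_ker
  have hχker := hker hmem
  rw [LinearMap.mem_ker, ContinuousLinearMap.coe_coe, hΛ, integral_conj_mul_self μ hn] at hχker
  exact one_ne_zero hχker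

/-- **The §4.1 equivalence for one function**: the period of `v` against `χ` is non-zero iff `χ`
lies in the closed span of the translates of `v`. -/
theorem integral_ne_zero_iff_mem_topologicalClosure_span [μ.IsMulLeftInvariant]
    [μ.IsMulRightInvariant] {χ : C(G, ℂ)} (hχ : ∀ s t, χ (s * t) = χ s * χ t)
    (hn : ∀ t, ‖χ t‖ = 1) (v : C(G, ℂ)) (T : G → C(G, ℂ)) (hT : ∀ t x, T t x = v (t * x)) :
    ∫ t, conj (χ t) * v t ∂μ ≠ 0 ↔ χ ∈ (Submodule.span ℂ (Set.range T)).topologicalClosure :=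
  ⟨mem_topologicalClosure_span_of_integral_ne_zero μ hχ hn v T hT,
    integral_ne_zero_of_mem_topologicalClosure_span μ hχ hn v T hT⟩

/-- **PERIOD.md §4.1 on the kernel.** For a translation-stable family `F : ι → C(G, ℂ)` (every
translate `x ↦ F i (t * x)` is again a member of the family), some member has a non-zero period
against the continuous unitary character `χ` iff `χ` lies in the closed span of the family. -/
theorem exists_integral_ne_zero_iff_mem_topologicalClosure_span [μ.IsMulLeftInvariant]
    [μ.IsMulRightInvariant] {χ : C(G, ℂ)} (hχ : ∀ s t, χ (s * t) = χ s * χ t)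
    (hn : ∀ t, ‖χ t‖ = 1) {ι : Type*} (F : ι → C(G, ℂ))
    (hF : ∀ i t, ∃ j, ∀ x, F j x = F i (t * x)) :
    (∃ i, ∫ t, conj (χ t) * F i t ∂μ ≠ 0) ↔
      χ ∈ (Submodule.span ℂ (Set.range F)).topologicalClosure := by
  constructor
  · rintro ⟨i, hi⟩
    choose j hj using hF i
    have hmem := mem_topologicalClosure_span_of_integral_ne_zero μ hχ hn (F i) (fun t => F (j t))
      (fun t x => hj t x) hi
    refine Submodule.topologicalClosure_mono ?_ hmem
    rw [Submodule.span_le]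
    rintro _ ⟨t, rfl⟩
    exact Submodule.subset_span ⟨j t, rfl⟩
  · intro hmem
    by_contra hex
    have hall : ∀ i, ∫ t, conj (χ t) * F i t ∂μ = 0 := fun i => by
      by_contra h
      exact hex ⟨i, h⟩
    obtain ⟨Λ, hΛ⟩ := exists_period_clm μ χ.continuous hn
    have hker : (Submodule.span ℂ (Set.range F)).topologicalClosure ≤
        LinearMap.ker (Λ : C(G, ℂ) →ₗ[ℂ] ℂ) := by
      apply Submodule.topologicalClosure_minimal
      · rw [Submodule.span_le]
        rintro _ ⟨i, rfl⟩
        simp only [SetLike.mem_coe, LinearMap.mem_ker, ContinuousLinearMap.coe_coe]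
        rw [hΛ]
        exact hall i
      · exact Λ.isClosed_ker
    have hχker := hker hmem
    rw [LinearMap.mem_ker, ContinuousLinearMap.coe_coe, hΛ, integral_conj_mul_self μ hn] at hχker
    exact one_ne_zero hχker

end Main

end HodgeRepro.T3P1.IsotypicProjection
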